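import Literature.Algebra.Module.PairedTorsionModulesAlternating
import HarnessLib

/-!
# `N ≅ C^ε ⊕ M ⊕ M` with `dim N[ϖ] ≤ 1` forces `M = 0` (so the stub `ϖ^{len M}·N` is all of `N`) — the
# algebra of «`ρ(n) = 0` or `1` implies `Stub^{(k)}(n) = H¹_{𝓕(n)}(K, T^{(k)})`» in Howard 2004, Lemma 1.6.4

Topic `Algebra/Module`; namespace `Literature.Algebra.Module`. THEOREMS ONLY: no definition, no named fact, no
instance, no notation, no `sorry` (net debt 0). Sequel to `PairedTorsionModulesAlternating.lean` (§6, the count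
`dim N[ϖ] = ε + 2·dim M[ϖ]` of Prop. 1.5.5) and `PowSmulImageLiftability.lean` (the liftability case); the
hypothesis `hsmall` of the cell's induction skeleton `Howard2004/StubLemmaInductionProofs.lean`.

## Source, verbatim

B. Howard, *The Heegner point Kolyvagin system*, Compositio Math. 140 (2004) 1439–1472, proof of
Lemma 1.6.4 (= arXiv:1202.6340 Lemma 2.6.4, held text `paper:arxiv-1202.6340` p0012 L10–13):

> The above case shows that `Stub^{(k)}(n) = 0`.  By Lemma (H.5 application), `ρ(n) = 0` or `1` implies
> that `Stub^{(k)}(n) = H¹_{𝓕(n)}(K, T^{(k)})`, and so we must have `ρ(n) > 1`.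

with `H¹_{𝓕(n)}(K, T^{(k)}) ≅ R^{(k),ε} ⊕ M ⊕ M` (Thm. 1.4.2), `Stub^{(k)}(n) = 𝔪^{len M} H¹_{𝓕(n)}(K, T^{(k)})`
(Def. 1.5.4) and `ρ(n) = dim_{R/𝔪} H¹_{𝓕(n)}(K, T̄) = dim_{R/𝔪} H¹_{𝓕(n)}(K, T^{(k)})[𝔪] = ε + 2 dim M[𝔪]`
(Lemma 1.3.3, Prop. 1.5.5).

## What is proved (theorems only; `R` a DVR with uniformiser `ϖ`, `hϖ : Irreducible ϖ`)

* §1 (any commutative ring) `eq_zero_of_torsionBy_eq_bot_of_pow_smul_eq_zero` — a `ϖ`-primary module without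
  `ϖ`-torsion is zero.
* §2 **`forall_eq_zero_of_finrank_torsionBy_le_one`** — for `N ≃ₗ[R] (Fin ε → C) × (M × M)` with
  `dim C[ϖ] = 1`, `M` finitely generated and `ϖ`-primary: `dim_{R/(ϖ)} N[ϖ] ≤ 1 ⟹ M = 0`
  (`ε + 2 dim M[ϖ] ≤ 1 ⟹ dim M[ϖ] = 0 ⟹ M[ϖ] = 0 ⟹ M = 0`), and the stub reading
  **`pow_length_smul_top_eq_top_of_finrank_torsionBy_le_one`**: `ϖ^{len M}·N = N`
  («`Stub^{(k)}(n) = H¹_{𝓕(n)}(K, T^{(k)})`»).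

Nothing here concerns Selmer groups; the identification `ρ(n) = dim H¹_{𝓕(n)}(K,T^{(k)})[𝔪]` (Lemma 1.3.3 for
`T̄`) is the Galois side's, and Lemma 1.6.4 / `thm161_dvrKolyvaginBound` are NOT proved by this file.

## References

* [Howard2004HeegnerKolyvagin] B. Howard, *The Heegner point Kolyvagin system*, Compositio Math. 140
  (2004), no. 6, 1439–1472, Lemma 1.6.4 (proof), Prop. 1.5.5, Def. 1.5.4 (arXiv:1202.6340 p. 12 L10–13;
  p. 10 L57–75).
* [Hungerford1974] T. W. Hungerford, *Algebra*, GTM 73, Ch. IV Lemma 6.10 (the counts `dim A[p]`).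
-/

open Module Submodule
open scoped Pointwise

namespace Literature.Algebra.Module

/-! ### §1 A `ϖ`-primary module with trivial `ϖ`-torsion is zero -/

section Primary

variable {R : Type*} [CommRing R] {ϖ : R} {M : Type*} [AddCommGroup M] [Module R M]

/-- **A `ϖ`-primary module with `M[ϖ] = 0` is zero**: if every element is killed by a power of `ϖ` and
`torsionBy R M ϖ = ⊥` then `M = 0` (peel off one `ϖ` at a time). [cite: Hungerford1974, Ch. IV Lemma 6.10 (i)–(iii) (PDF p. 305)] -/
theorem eq_zero_of_torsionBy_eq_bot_of_pow_smul_eq_zero (hM : ∀ m : M, ∃ j : ℕ, ϖ ^ j • m = 0)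
    (h : torsionBy R M ϖ = ⊥) (m : M) : m = 0 := by
  obtain ⟨j, hj⟩ := hM m
  induction j generalizing m with
  | zero => simpa using hj
  | succ j ih =>
    apply ih
    have hmem : ϖ ^ j • m ∈ torsionBy R M ϖ := by
      rw [mem_torsionBy_iff, smul_smul, ← pow_succ', hj]
    rw [h, mem_bot] at hmem
    exact hmem

end Primary

/-! ### §2 `dim N[ϖ] ≤ 1` for `N ≅ C^ε ⊕ M ⊕ M` forces `M = 0` and `ϖ^{len M}·N = N` -/

section SmallSocle

variable {R : Type*} [CommRing R] [IsDomain R] [IsDiscreteValuationRing R] {ϖ : R}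
  {N : Type*} [AddCommGroup N] [Module R N]

/-- **«`ρ(n) = 0` or `1` implies `Stub(n) = 𝓗(n)`», the vanishing of `M`:** for `N ≅ C^ε × (M × M)` with
`dim_{R/(ϖ)} C[ϖ] = 1` (e.g. `C = R/𝔪ᵏ`, `k ≥ 1`), `M` finitely generated and `ϖ`-primary, the bound
`dim_{R/(ϖ)} N[ϖ] ≤ 1` forces `M = 0` — by Prop. 1.5.5's count `dim N[ϖ] = ε + 2·dim M[ϖ]`
(`finrank_torsionBy_eq_of_linearEquiv_pi_prod_prod_self`), `dim M[ϖ] = 0`, so `M[ϖ] = 0`, so `M = 0` (§1).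
[cite: Howard2004HeegnerKolyvagin, Lemma 1.6.4 (proof) with Prop. 1.5.5 = arXiv:1202.6340 p0012 L10–L13; p0010 L67–L75] -/
theorem forall_eq_zero_of_finrank_torsionBy_le_one (hϖ : Irreducible ϖ) {ε : ℕ}
    {C : Type*} [AddCommGroup C] [Module R C] [Module.Finite R C]
    (hC : Module.finrank (R ⧸ R ∙ ϖ) ↥(torsionBy R C ϖ) = 1)
    {M : Type*} [AddCommGroup M] [Module R M] [Module.Finite R M]
    (hM : ∀ m : M, ∃ j : ℕ, ϖ ^ j • m = 0) (e : N ≃ₗ[R] (Fin ε → C) × (M × M))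
    (h : Module.finrank (R ⧸ R ∙ ϖ) ↥(torsionBy R N ϖ) ≤ 1) : ∀ m : M, m = 0 := by
  have hcount := finrank_torsionBy_eq_of_linearEquiv_pi_prod_prod_self hϖ hC e
  have h0 : Module.finrank (R ⧸ R ∙ ϖ) ↥(torsionBy R M ϖ) = 0 := by omega
  haveI : Ideal.IsMaximal (R ∙ ϖ) := PrincipalIdealRing.isMaximal_of_irreducible hϖ
  letI : Field (R ⧸ R ∙ ϖ) := Ideal.Quotient.field (R ∙ ϖ)
  haveI : Module.Finite (R ⧸ R ∙ ϖ) ↥(torsionBy R M ϖ) := finite_torsionBy ϖ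
  have hbot : torsionBy R M ϖ = ⊥ := by
    rw [eq_bot_iff]
    intro x hx
    have hsub : Subsingleton ↥(torsionBy R M ϖ) := Module.finrank_zero_iff.1 h0
    have := hsub.elim ⟨x, hx⟩ 0
    rw [mem_bot]
    exact congrArg Subtype.val this
  exact eq_zero_of_torsionBy_eq_bot_of_pow_smul_eq_zero hM hbot

/-- **«`ρ(n) = 0` or `1` implies `Stub^{(k)}(n) = H¹_{𝓕(n)}(K, T^{(k)})`», the stub reading:** under the same
hypotheses, `ϖ^{len_R M}·N = N` — `M = 0` has length `0` and `ϖ⁰·N = N` (`Stub = 𝔪^{len M} 𝓗`, Def. 1.5.4).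
[cite: Howard2004HeegnerKolyvagin, Lemma 1.6.4 (proof) with Def. 1.5.4 = arXiv:1202.6340 p0012 L10–L13; p0010 L57–L62] -/
theorem pow_length_smul_top_eq_top_of_finrank_torsionBy_le_one (hϖ : Irreducible ϖ) {ε : ℕ}
    {C : Type*} [AddCommGroup C] [Module R C] [Module.Finite R C]
    (hC : Module.finrank (R ⧸ R ∙ ϖ) ↥(torsionBy R C ϖ) = 1)
    {M : Type*} [AddCommGroup M] [Module R M] [Module.Finite R M]
    (hM : ∀ m : M, ∃ j : ℕ, ϖ ^ j • m = 0) (e : N ≃ₗ[R] (Fin ε → C) × (M × M))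
    (h : Module.finrank (R ⧸ R ∙ ϖ) ↥(torsionBy R N ϖ) ≤ 1) :
    ϖ ^ (Module.length R M).toNat • (⊤ : Submodule R N) = ⊤ := by
  have hz := forall_eq_zero_of_finrank_torsionBy_le_one hϖ hC hM e h
  haveI : Subsingleton M := ⟨fun a b => by rw [hz a, hz b]⟩
  rw [Module.length_eq_zero_iff.2 ‹Subsingleton M›]
  simp

end SmallSocle

end Literature.Algebra.Module
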